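import Literature.MathematicalPhysics.QuantumFieldTheory.Balaban1983to89.B9Thm314Thm315LayerR
import Literature.MathematicalPhysics.QuantumFieldTheory.Balaban1983to89.B9Thm314WholePinGeometry
import Literature.MathematicalPhysics.QuantumFieldTheory.Balaban1983to89.B9GeoNormsKLevelModelSignsV1

/-!
# `Balaban1983to89.B9Thm314Thm315LayerRSat` — the A6 SATISFIABILITY CERTIFICATE (director-ym №189 (3), standing rule) for the R-twins of rows 22–24
# (`B9Thm314Thm315LayerR`, p540501): every displayed hypothesis of `thm314_pair_layerOfLettersR` (Thm 3.14, rows 22–23) and of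
# `thm315FullPrinted_sectE_of_3185_onR` ∕ `t315_opsYSectE_of_3185_onR` (Thm 3.15, row 24) is JOINTLY INHABITED — at EVERY class parameter `R₁ R₂` —
# by the walk-less expansion of the zero letter, and the landed theorems FIRE there; the same for dag-n06-m's originals over `bg9Y` (by `rfl`)

T. Bałaban, *Propagators for lattice gauge theories in a background field*, Commun. Math. Phys. **99** (1985) 389–434
[`Balaban1985BackgroundPropagators`, "B9"].
pub-ymgap Track A, node N06 = `Dag.B9_main`; seat `pub-ymgap-dag-n06-f` g15.  Referee grading of record: dag-ref-A g21 READ-39 on p540501 — «PASS 8∕8 ·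
A6-UNCHECKED per №189 (3)» (post-rule landing, dag-n06-m's member-local binder set inherited, no in-file witness).  №189 (3): *«every junction ∕ knit
lemma whose hypotheses are member-local binders ships … a satisfiability witness — `example : ∃ …, <the binders>` or a named inhabitant …»*.

statement-level skeleton of published theorems with citation tags; proofs where landed; nothing here is a claim about the
Yang–Mills mass gap

THE PRINTED LOCI.  Thm 3.14 (3.154) pp. 426–427 (proof p. 427: *"We take random walk expansions for both operators …"*); Thm 3.10 (3.107)–(3.108)
pp. 415–416 (*"the expansion (3.107) is convergent in all norms"*); Thm 3.15 (3.185)–(3.187) p. 432; the classes (3.35)–(3.36) p. 396.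

WHAT IS CERTIFIED (kernel-checked, count-neutral).
* §1 generic tools over r1's carriers (no definition introduced): `exists_walkless_expansion` — over any family there is an expansion with NO
  walks (`Walk := PEmpty`), zero terms, `LocDep := True`, `Converges := True`; `thm310AllNormsPrinted_of_isEmpty` — Theorem 3.10's all-norms schema `B9SectCWalkTermsAllNorms.Thm310AllNormsPrinted` holds
  at ANY family of walk-less expansions that converge (all constants `1`: every per-walk clause quantifies over an empty type); `walkSetsSpec_empty`,
  `walkWeightsSummable_empty` — the EMPTY walk sets `W := ∅` obey dag-n06-m's `WalkSetsSpec` (vacuously) and `WalkWeightsSummable` (`Σ_∅ = 0 ≤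
  N₀D₀ⁿe^{−δ′d}`); `partialOp_eq_zero_of_isEmpty`, ★ `expansionReads_zero_of_isEmpty` — dag-n06-m's located reading `ExpansionReads i cfg O T W U`
  (p. 427 ∕ p. 416) HOLDS for the ZERO letter `O(U) = 0` at any walk-less expansion: the partial sums and the letter are both `0` on every read set;
  `isEmpty_pairExpansion_walk`.
* §2 ★★★ `thm314_pair_layerOfLettersR_binders_inhabited_flat R₁ R₂ c35` — at the letters `𝔏 := covLettersY_flat` (def-Y; `Kdiff = 0`), `dOmega :=
  dOmegaY`, `Ps := (·.isRight)`: `∃ E₁ E₂ T₁ T₂ D₁ X₂ Meets₂ r₀ W₁ W₂, L₁ ∧ L₂ ∧ hr ∧ S ∧ hdΩ ∧ h₁ ∧ h₂ ∧ hW₁ ∧ hW₂ ∧ hcnt₁ ∧ hcnt₂ ∧ hexp` — EVERY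
  displayed hypothesis of `thm314_pair_layerOfLettersR` jointly inhabited at EVERY class parameter `R₁ R₂` (so in particular at print's (3.35) ∕
  (3.36) families `regY335`, `regY336`, whose class contains `U = 1`) and every `c35` (the binders `𝔈`, `OmK` enter no hypothesis): `E₁ = E₂ :=`
  the walk-less expansion, `T := 0`, `D₁ := locDataY x _ ⊤ ⊥ 0` with dag-n06-m's `locDataY_laws` (walk fields vacuous, the six geometric ones the
  pinned theorems), `S := modelSignsOn_geo9K`, `hdΩ := dOmegaY_nonneg`, `W := ∅`; ★ `thm314_pair_layerOfLettersR_fires_flat` — the landed theorem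
  APPLIED to that witness (rows 22–23's statement over `bg9YR` is not an ex-falso shell).
* §3 `hyps3185R_flat` — the `h` binder of the two Thm-3.15 R-twins at def-Y's `sectELettersY_flat` + `rwLettersEY_flat`, every `R₁ R₂ 𝔏 U α₀`
  (dag-n06-m's `hyps3185_flat` + def-Y's `hasRWExpCY_flat` by name); ★★ `thm315_onR_binders_inhabited_flat` (∃-form, constants `a₀ = δ₁ = B₁ = mE = mF
  = 1`, `r = 0`); ★ `thm315FullPrinted_sectE_of_3185_onR_fires_flat`, ★ `t315_opsYSectE_of_3185_onR_fires_flat`.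
* §4 the same certificates for dag-n06-m's PRE-RULE originals `thm314_pair_layerOfLetters` ∕ `t315_opsYSectE_of_3185_on` over `bg9Y` (def-Y's
  `bg9Y = bg9YR regY335 regY336`, `rfl`; through `B9Thm314Thm315LayerR`'s `_regY_iff`).

HONEST SCOPE.  A JUNK inhabitant by design — the zero letter read by the walk-less expansion — certifying exactly what №189 (3) asks: the displayed
member-local binders of the three R-twins are JOINTLY SATISFIABLE (contrast the Thm 3.3 junction, №189 (1), and the N22 J9 knit, №193), and the
theorems instantiate.  Nothing more: the content of rows 22–24 lives at GENUINE letters and expansions; in particular the certificate-of-record block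
(`B9Thm314Thm315RecordDE.thm314_pair_opsYOfRecordDE` at def-Y's `lettersYOfRecordV4`, genuine `KdiffY = GAv2Y − GAsndY`) is NOT witnessed here —
its honest inhabitant is the random-walk expansion of G(Ω, U) − G(Ω′, U), i.e. Theorem 3.14's mathematics (the member family has unbounded
`M = (ℓ+1)·Mh`, so no regime-empty shortcut inhabits it either).  Nothing of [B9] asserted; N06 NOT discharged; one finite-torus programme at fixed ε;
nothing continuum ∕ ℝ⁴ ∕ OS ∕ mass-gap ∕ Clay.
-/

noncomputable section

namespace Literature.MathematicalPhysics.QuantumFieldTheory.Balaban1983to89.B9Thm314Thm315LayerRSat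

open B9PinMembersKLevelV1 (MemberY geo9Y bg9Y)
open B9PinCarriersKLevelV1 (OperatorLayerY)
open B9BackgroundsKLevelV1R (RegFamY bg9YR regY335 regY336 kernelFamilyR siteKernelR)
open B9 B9Thm314 Node00
open B6KLevelCensusIndexV1 (KIdx)
open B9GeoNormsKLevelV1 (geo9K)
open B9GeoNormsKLevelModelSignsV1 (modelSignsOn_geo9K)
open B9Thm314WholeExpansionReads (ExpansionReads ApproxOn partialOp probes)
open B9Thm314WholeSummation (WalkSetsSpec WalkWeightsSummable)
open B9Thm314WholePair (pairExpansion locData₂)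
open B9Thm314WholePairWalks (pairWalkSets)
open B9Thm314WholeCancellationLayer (pairOp thm314_pair_layerOfLetters)
open B9Thm314WholePinGeometry (locDataY locDataY_laws)
open B9SectCWalkTermsAllNorms (Thm310AllNormsPrinted)
open B9FromB6ModelSignsOn
open B9PinGeometryKLevelV1 (dOmegaY OmKY dOmegaY_nonneg inΛY unitDistY c35Y)
open B9Thm315WholeSectERep (LocalOuterY)
open B9Thm315WholeSectERepOn (DecayMidOnY hyps3185_flat t315_opsYSectE_of_3185_on)
open B9Thm314Thm315LayerR (thm314_pair_layerOfLettersR thm314_pair_layerOfLettersR_regY_iff thm315FullPrinted_sectE_of_3185_onR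
  t315_opsYSectE_of_3185_onR t315_opsYSectE_of_3185_onR_regY_iff)
open B7Prop2SpecialUnitary (specialUnitaryUnits)

variable {d ℓ : ℕ} {hd : 1 ≤ d + 1} {hL : Odd (ℓ + 1) ∧ 1 < ℓ + 1} {b₀ b₁ : ℝ} {Mstar : ℕ}
variable {𝔸 : Type} [NormedRing 𝔸] [NormedAlgebra ℂ 𝔸] [CompleteSpace 𝔸] {G : Subgroup 𝔸ˣ}

/-! ## §1 Generic tools: the walk-less expansion, the empty walk sets, the zero letter -/

section Tools

/-- **A WALK-LESS, CONVERGENT EXPANSION EXISTS** over any family of geometries ∕ backgrounds: no walks (`Walk := PEmpty`), zero terms, local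
dependence and convergence `True`.  An inhabitant of r1's carrier `B9.RWExpansion` used only as a satisfiability witness (it is NOT the expansion
(3.90) ∕ (3.107) of any operator but `0`); stated as an existence fact so that no definition is introduced.
[cite: Balaban1985BackgroundPropagators, (3.90) p.409 + (3.107) p.415 (the carrier), bookkeeping (non-vacuity)] -/
theorem exists_walkless_expansion {I : Type} (geo : I → B9.Geometry) (bg : I → B9.Backgrounds) :
    ∃ E : ∀ i, B9.RWExpansion (geo i) (bg i), (∀ i, IsEmpty (E i).Walk) ∧ ∀ (i : I) (U : (bg i).Cfg), (E i).Converges U :=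
  ⟨fun _ => ⟨PEmpty, fun _ => 0, fun _ _ => False, fun _ _ => False, fun _ _ _ => 0, fun _ _ _ _ => 0, fun _ _ => True, fun _ => True⟩,
    fun _ => ⟨fun ω => PEmpty.elim ω⟩, fun _ _ => trivial⟩

/-- the pair expansion of two walk-less expansions is walk-less. [cite: Balaban1985BackgroundPropagators, Thm 3.14 proof p.427 («We take random walk expansions for both operators»), bookkeeping] -/
theorem isEmpty_pairExpansion_walk {g : B9.Geometry} {B : B9.Backgrounds} {E₁ E₂ : B9.RWExpansion g B}
    (h₁ : IsEmpty E₁.Walk) (h₂ : IsEmpty E₂.Walk) (P₁ : E₁.Walk → Prop) (P₂ : E₂.Walk → Prop) :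
    IsEmpty (pairExpansion E₁ E₂ P₁ P₂).Walk := by
  refine ⟨fun ω => ?_⟩
  rcases ω with ⟨ω, -⟩ | ⟨ω, -⟩
  · exact h₁.false ω
  · exact h₂.false ω

/-- **THEOREM 3.10's ALL-NORMS SCHEMA AT A FAMILY OF WALK-LESS, CONVERGENT EXPANSIONS** holds with all constants `1`: the convergence clause is the
hypothesis, and each of the per-walk clauses (`LocDep`, `TermIneq342_346`, `TermIneq343_345`) quantifies over an empty type of walks.
[cite: Balaban1985BackgroundPropagators, Thm 3.10 (3.107)–(3.108) pp.415–416, bookkeeping (non-vacuity)] -/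
theorem thm310AllNormsPrinted_of_isEmpty {I : Type} (c35 : ℝ) (geo : I → B9.Geometry) (bg : I → B9.Backgrounds)
    (E : ∀ i, B9.RWExpansion (geo i) (bg i)) (hE : ∀ i, IsEmpty (E i).Walk) (hconv : ∀ (i : I) (U : (bg i).Cfg), (E i).Converges U)
    (termK : ∀ i, (E i).Walk → B9.KernelFamily (geo i) (bg i)) : Thm310AllNormsPrinted c35 geo bg E termK :=
  ⟨1, 1, 1, 1, 1, fun _ => 1, fun _ => 1, fun _ _ => 1, one_pos, one_pos, one_pos, one_pos, one_pos,
    fun i _ _ _ _ U _ =>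
      ⟨hconv i U, fun ω => ((hE i).false ω).elim,
        ⟨fun ω => ((hE i).false ω).elim, fun ω => ((hE i).false ω).elim⟩,
        ⟨fun ω => ((hE i).false ω).elim, fun ω => ((hE i).false ω).elim, fun ω => ((hE i).false ω).elim⟩⟩⟩

/-- **THE EMPTY WALK SETS OBEY THE MEMBERSHIP LAWS** (vacuously). [cite: Balaban1985BackgroundPropagators, Thm 3.7 (3.90) p.409, bookkeeping (non-vacuity)] -/
theorem walkSetsSpec_empty {g : B9.Geometry} {B : B9.Backgrounds} (E : B9.RWExpansion g B) :
    WalkSetsSpec E (fun _ _ _ => ∅) :=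
  ⟨fun _ _ _ ω h => absurd h (Finset.notMem_empty ω), fun _ _ _ ω h => absurd h (Finset.notMem_empty ω),
    fun _ _ _ ω h => absurd h (Finset.notMem_empty ω)⟩

/-- **THE EMPTY WALK SETS ARE SUMMABLE, UNIFORMLY IN THE MEMBER**: `Σ_{ω ∈ ∅} e^{−½δd(ω)} = 0 ≤ N₀D₀ⁿe^{−δ′d(y,y′)}` with `N₀ = D₀ = δ′ = 1`.
[cite: Balaban1985BackgroundPropagators, Cor. 3.8 (3.91)–(3.94) p.410, bookkeeping (non-vacuity)] -/
theorem walkWeightsSummable_empty {I : Type} (geo : I → B9.Geometry) (bg : I → B9.Backgrounds) (E : ∀ i, B9.RWExpansion (geo i) (bg i)) :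
    WalkWeightsSummable geo bg E (fun _ _ _ _ => ∅) := by
  intro δ _
  refine ⟨1, 1, 1, one_pos, one_pos, one_pos, fun i n y y' => ?_⟩
  simp only [Finset.sum_empty]
  positivity

variable (i : KIdx d ℓ hd hL b₀ b₁) {B : B9.Backgrounds} {E : B9.RWExpansion (geo9K i) B}

/-- the partial sums of a walk-less expansion vanish. [cite: Balaban1985BackgroundPropagators, (3.107) p.415, bookkeeping (non-vacuity)] -/
theorem partialOp_eq_zero_of_isEmpty (hE : IsEmpty E.Walk) (W : ℕ → (geo9K i).Site → (geo9K i).Site → Finset E.Walk)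
    (T : E.Walk → BondOpY 𝔸 i) (U : CfgY 𝔸 i) (y y' : (geo9K i).Site) (Ψ : FBondY i → 𝔸) (m : ℕ) :
    partialOp i W T U y y' Ψ m = 0 :=
  Finset.sum_eq_zero fun _ _ => Finset.sum_eq_zero fun ω _ => (hE.false ω).elim

/-- ★ **THE ZERO LETTER IS READ BY ANY WALK-LESS EXPANSION** (dag-n06-m's located hypothesis `ExpansionReads`, p. 427 ∕ p. 416): for `O(U) = 0` the
partial sums (all `0`) approximate `O(U)Ψ = 0` on every read set, to every `ε > 0`, for every probe input. [cite: Balaban1985BackgroundPropagators, Thm 3.14 proof p.427 + Thm 3.10 (3.107) p.415 + p.416, bookkeeping (non-vacuity)] -/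
theorem expansionReads_zero_of_isEmpty (hE : IsEmpty E.Walk) (cfg : B.Cfg → CfgY 𝔸 i) {O : BondOpY 𝔸 i} (U : B.Cfg)
    (hO : ∀ Ψ : FBondY i → 𝔸, O (cfg U) Ψ = 0) (T : E.Walk → BondOpY 𝔸 i)
    (W : ℕ → (geo9K i).Site → (geo9K i).Site → Finset E.Walk) : ExpansionReads i cfg O T W U := by
  have key : ∀ (S : Set (FBondY i)) (y y' : (geo9K i).Site) (Ψ : FBondY i → 𝔸),
      ApproxOn i S (O (cfg U) Ψ) (partialOp i W T (cfg U) y y' Ψ) := by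
    intro S y y' Ψ ε hε
    refine ⟨0, fun z _ => ?_⟩
    rw [hO, partialOp_eq_zero_of_isEmpty i hE]
    simp only [Pi.zero_apply, sub_zero, norm_zero]
    exact hε.le
  exact ⟨fun y y' _ _ _ Ψ _ => key _ y y' Ψ, fun y y' _ _ _ _ _ Ψ _ => key _ y y' Ψ, fun y y' _ _ _ _ _ Ψ _ => key _ y y' Ψ⟩

end Tools

/-! ## §2 Theorem 3.14 (rows 22–23): the binders of `thm314_pair_layerOfLettersR` are jointly inhabited at every class parameter -/

section Thm314

variable (R₁ R₂ : RegFamY d ℓ hd hL b₀ b₁ Mstar 𝔸)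

/-- ★★★ **THE A6 CERTIFICATE FOR ROWS 22–23's R-TWIN** (`example : ∃ …, <the binders>` of director-ym №189 (3)): at EVERY class parameter `R₁ R₂` and
every `c35`, WITH THE LETTERS NAMED — `𝔏 := covLettersY_flat` (def-Y; `Kdiff = 0`), `dOmega := dOmegaY` ((3.154) at the pin), `Ps :=` the bond-sector
arguments (dag-n03-b's `modelSignsOn_geo9K`) — the remaining displayed hypotheses of `B9Thm314Thm315LayerR.thm314_pair_layerOfLettersR` are JOINTLY
INHABITED: there are expansions `E₁ E₂` with walk-term letters `T₁ T₂`, localisation data `D₁ X₂ Meets₂`, a diameter bound `r₀` and walk sets `W₁ W₂`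
satisfying BOTH law packages `L₁ L₂`, `hr`, the model signs `S`, `hdΩ`, the two Theorem-3.10 all-norms leaves `h₁ h₂`, `hW₁ hW₂ hcnt₁ hcnt₂` and the
located approximation identity `hexp` (the theorem's binders `𝔈`, `OmK` enter no hypothesis and stay free).  Witness: the walk-less expansions
(`exists_walkless_expansion`), zero walk-term letters, dag-n06-m's `locDataY ∕ locDataY_laws` with trivial walk fields and `diam = r₀ = 0`, empty walk
sets.  Junk inhabitant; content only at genuine letters ∕ expansions. [cite: Balaban1985BackgroundPropagators, Thm 3.14 (3.154) pp.426–427 + Thm 3.10 pp.415–416, bookkeeping (non-vacuity)] -/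
theorem thm314_pair_layerOfLettersR_binders_inhabited_flat (c35 : ℝ) :
    ∃ (E₁ E₂ : ∀ x : MemberY d ℓ hd hL b₀ b₁ Mstar, RWExpansion (geo9Y x) (bg9YR 𝔸 G R₁ R₂ x))
      (T₁ : ∀ x : MemberY d ℓ hd hL b₀ b₁ Mstar, (E₁ x).Walk → BondOpY 𝔸 x.toKIdx)
      (T₂ : ∀ x : MemberY d ℓ hd hL b₀ b₁ Mstar, (E₂ x).Walk → BondOpY 𝔸 x.toKIdx)
      (D₁ : ∀ x, LocData (geo9Y x) (bg9YR 𝔸 G R₁ R₂ x) (E₁ x))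
      (X₂ : ∀ x, (E₂ x).Walk → ℕ → (geo9Y x).Site → Prop) (Meets₂ : ∀ x, (E₂ x).Walk → ℕ → Prop) (r₀ : ℝ)
      (W₁ : ∀ x, ℕ → (geo9Y x).Site → (geo9Y x).Site → Finset (E₁ x).Walk)
      (W₂ : ∀ x, ℕ → (geo9Y x).Site → (geo9Y x).Site → Finset (E₂ x).Walk),
      (∀ x, (D₁ x).Laws (dOmegaY x)) ∧ (∀ x, (locData₂ (D₁ x) (X₂ x) (Meets₂ x)).Laws (dOmegaY x)) ∧
      (∀ x, (D₁ x).diam ≤ r₀) ∧ (∀ x : MemberY d ℓ hd hL b₀ b₁ Mstar, ModelSignsOn (geo9Y x) fun lam => lam.isRight = true) ∧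
      (∀ (x : MemberY d ℓ hd hL b₀ b₁ Mstar) (y y' : (geo9Y x).Site), 0 ≤ dOmegaY x y y') ∧
      Thm310AllNormsPrinted c35 geo9Y (bg9YR 𝔸 G R₁ R₂) E₁
        (fun x ω => kernelFamilyB x.toKIdx (bg9YR 𝔸 G R₁ R₂ x) (fun U => U) (T₁ x ω) (covLettersY_flat 𝔸 x).parB) ∧
      Thm310AllNormsPrinted c35 geo9Y (bg9YR 𝔸 G R₁ R₂) E₂
        (fun x ω => kernelFamilyB x.toKIdx (bg9YR 𝔸 G R₁ R₂ x) (fun U => U) (T₂ x ω) (covLettersY_flat 𝔸 x).parB) ∧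
      (∀ x, WalkSetsSpec (E₁ x) (W₁ x)) ∧ (∀ x, WalkSetsSpec (E₂ x) (W₂ x)) ∧
      WalkWeightsSummable geo9Y (bg9YR 𝔸 G R₁ R₂) E₁ W₁ ∧ WalkWeightsSummable geo9Y (bg9YR 𝔸 G R₁ R₂) E₂ W₂ ∧
      (∀ (x : MemberY d ℓ hd hL b₀ b₁ Mstar) (U : (bg9YR 𝔸 G R₁ R₂ x).Cfg), (E₁ x).Converges U ∧ (E₂ x).Converges U →
        ExpansionReads x.toKIdx (B := bg9YR 𝔸 G R₁ R₂ x) (fun U => U) (covLettersY_flat 𝔸 x).Kdiff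
          (pairOp (D₁ x).Touches (locData₂ (D₁ x) (X₂ x) (Meets₂ x)).Touches (T₁ x) (T₂ x))
          (pairWalkSets (W₁ x) (W₂ x) (D₁ x).Touches (locData₂ (D₁ x) (X₂ x) (Meets₂ x)).Touches) U) := by
  obtain ⟨E, hE, hconv⟩ := exists_walkless_expansion geo9Y (bg9YR 𝔸 G R₁ R₂)
  refine ⟨E, E, fun x _ => 0, fun x _ => 0, fun x => locDataY x (E x) (fun _ _ _ => True) (fun _ _ => False) 0,
    fun _ _ _ _ => True, fun _ _ _ => False, 0, fun _ _ _ _ => ∅, fun _ _ _ _ => ∅,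
    fun x => locDataY_laws x (E x) (fun ω => ((hE x).false ω).elim) (fun ω => ((hE x).false ω).elim) (fun ω => ((hE x).false ω).elim),
    fun x => locDataY_laws x (E x) (fun ω => ((hE x).false ω).elim) (fun ω => ((hE x).false ω).elim) (fun ω => ((hE x).false ω).elim),
    fun _ => le_rfl, fun x => modelSignsOn_geo9K x.toKIdx, fun x y y' => dOmegaY_nonneg x y y',
    thm310AllNormsPrinted_of_isEmpty c35 geo9Y (bg9YR 𝔸 G R₁ R₂) E hE hconv _,
    thm310AllNormsPrinted_of_isEmpty c35 geo9Y (bg9YR 𝔸 G R₁ R₂) E hE hconv _,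
    fun _ => walkSetsSpec_empty _, fun _ => walkSetsSpec_empty _, walkWeightsSummable_empty _ _ _, walkWeightsSummable_empty _ _ _,
    fun x U _ => ?_⟩
  exact expansionReads_zero_of_isEmpty x.toKIdx (isEmpty_pairExpansion_walk (hE x) (hE x) _ _) (fun U => U) U (fun _ => rfl) _ _

variable [FiniteDimensional ℂ 𝔸]

/-- ★ **ROWS 22–23's R-TWIN FIRES**: `B9Thm314Thm315LayerR.thm314_pair_layerOfLettersR` APPLIED to the witness of
`thm314_pair_layerOfLettersR_binders_inhabited_flat` — at EVERY class parameter `R₁ R₂`, every `𝔈`, every `c35`: its conclusion `Thm314Printed ∧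
Thm314LocalPrinted` (with `dOmegaY`, `OmKY`) for the `Kdiff` kernel family of the layer of the FLAT letters over `bg9YR 𝔸 G R₁ R₂`.  A junk instantiation
(the statement is about the reading of the letter `0`); it shows the landed theorem is not an ex-falso shell.
[cite: Balaban1985BackgroundPropagators, Thm 3.14 (3.154) pp.426–427, bookkeeping (non-vacuity)] -/
theorem thm314_pair_layerOfLettersR_fires_flat (𝔈 : ∀ x : MemberY d ℓ hd hL b₀ b₁ Mstar, ExpLettersY 𝔸 G x) (c35 : ℝ) :
    Thm314Printed c35 geo9Y (bg9YR 𝔸 G R₁ R₂)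
        (fun x => kernelFamilyR R₁ R₂ (operatorLayerYOfLetters 𝔸 G x (covLettersY_flat 𝔸 x) (𝔈 x)).Kdiff) dOmegaY ∧
      Thm314LocalPrinted c35 geo9Y (bg9YR 𝔸 G R₁ R₂)
        (fun x => kernelFamilyR R₁ R₂ (operatorLayerYOfLetters 𝔸 G x (covLettersY_flat 𝔸 x) (𝔈 x)).Kdiff) OmKY dOmegaY := by
  obtain ⟨E₁, E₂, T₁, T₂, D₁, X₂, Meets₂, r₀, W₁, W₂, L₁, L₂, hr, S, hdΩ, h₁, h₂, hW₁, hW₂, hcnt₁, hcnt₂, hexp⟩ :=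
    thm314_pair_layerOfLettersR_binders_inhabited_flat (G := G) R₁ R₂ c35
  exact thm314_pair_layerOfLettersR R₁ R₂ (fun x => covLettersY_flat 𝔸 x) 𝔈 T₁ T₂ D₁ X₂ Meets₂ L₁ L₂ r₀ hr S hdΩ h₁ h₂ W₁ W₂
    hW₁ hW₂ hcnt₁ hcnt₂ hexp

end Thm314

/-! ## §3 Theorem 3.15 (row 24): the binders of the two (3.185)-slot R-twins are jointly inhabited at every class parameter -/

section Thm315

variable (R₁ R₂ : RegFamY d ℓ hd hL b₀ b₁ Mstar 𝔸) [FiniteDimensional ℂ 𝔸]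

/-- **THE `h` BINDER OF THE TWO THM-3.15 R-TWINS AT def-Y's FLAT SECT. E ∕ WALK LETTERS**, for EVERY `R₁ R₂`, every base letters `𝔏`, every member,
`α₀`, `U` (the class premises are not even used): the (3.185) identity, the walk-expansion slot at rate `1`, the outer locality with `r = 0`,
`m_E = m_F = 1`, and the Λ-restricted middle decay with `B₁ = 1`, rate `1` — dag-n06-m's `hyps3185_flat` and def-Y's `hasRWExpCY_flat` by name.
[cite: Balaban1985BackgroundPropagators, Thm 3.15 (3.185)–(3.187) p.432 + (3.169) p.430, bookkeeping (non-vacuity)] -/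
theorem hyps3185R_flat (𝔏 : ∀ x : MemberY d ℓ hd hL b₀ b₁ Mstar, CovLettersY 𝔸 x) :
    ∀ (x : MemberY d ℓ hd hL b₀ b₁ Mstar) (α₀ : ℝ), 0 < α₀ → (geo9Y x).M * α₀ ≤ 1 →
      ∀ U : (bg9YR 𝔸 G R₁ R₂ x).Cfg, (bg9YR 𝔸 G R₁ R₂ x).Reg335 c35Y α₀ U → (bg9YR 𝔸 G R₁ R₂ x).Reg336 c35Y α₀ U →
        givenBy3185Y x (𝔏 x) (sectELettersY_flat 𝔸 x) U ∧ hasRWExpCY (rwLettersEY_flat 𝔸 G x) U 1 ∧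
          LocalOuterY x (sectELettersY_flat 𝔸 x) 0 1 1 U ∧ DecayMidOnY x (𝔏 x) (sectELettersY_flat 𝔸 x) 1 U 1 :=
  fun x _ _ _ U _ _ =>
    ⟨(hyps3185_flat x (𝔏 x) U zero_le_one 1).1, hasRWExpCY_flat 𝔸 G x U 1, (hyps3185_flat x (𝔏 x) U zero_le_one 1).2.1,
      (hyps3185_flat x (𝔏 x) U zero_le_one 1).2.2⟩

/-- ★★ **THE A6 CERTIFICATE FOR ROW 24's R-TWINS** (∃-form of №189 (3)): for EVERY `R₁ R₂` and every base letters `𝔏` there are constants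
`a₀ δ₁ B₁ r mE mF`, residual Sect. E letters `𝔢` and walk letters `𝔴` inhabiting ALL displayed hypotheses `ha₀ hδ₁ hB₁ hmE hmF h` of
`thm315FullPrinted_sectE_of_3185_onR` (and, at `𝔸 = Matrix (Fin N) (Fin N) ℂ`, of `t315_opsYSectE_of_3185_onR`).  Junk inhabitant (`C^{(k)}(Λ) = 0` there).
[cite: Balaban1985BackgroundPropagators, Thm 3.15 (3.185)–(3.187) p.432, bookkeeping (non-vacuity)] -/
theorem thm315_onR_binders_inhabited_flat (𝔏 : ∀ x : MemberY d ℓ hd hL b₀ b₁ Mstar, CovLettersY 𝔸 x) :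
    ∃ (a₀ δ₁ B₁ r mE mF : ℝ) (𝔢 : ∀ x : MemberY d ℓ hd hL b₀ b₁ Mstar, SectELettersY 𝔸 x)
      (𝔴 : ∀ x : MemberY d ℓ hd hL b₀ b₁ Mstar, RWLettersEY 𝔸 G x),
      0 < a₀ ∧ 0 < δ₁ ∧ 0 < B₁ ∧ 0 < mE ∧ 0 < mF ∧
      ∀ (x : MemberY d ℓ hd hL b₀ b₁ Mstar) (α₀ : ℝ), 0 < α₀ → (geo9Y x).M * α₀ ≤ a₀ →
        ∀ U : (bg9YR 𝔸 G R₁ R₂ x).Cfg, (bg9YR 𝔸 G R₁ R₂ x).Reg335 c35Y α₀ U → (bg9YR 𝔸 G R₁ R₂ x).Reg336 c35Y α₀ U →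
          givenBy3185Y x (𝔏 x) (𝔢 x) U ∧ hasRWExpCY (𝔴 x) U δ₁ ∧
            LocalOuterY x (𝔢 x) r mE mF U ∧ DecayMidOnY x (𝔏 x) (𝔢 x) B₁ U δ₁ :=
  ⟨1, 1, 1, 0, 1, 1, fun x => sectELettersY_flat 𝔸 x, fun x => rwLettersEY_flat 𝔸 G x, one_pos, one_pos, one_pos, one_pos, one_pos,
    hyps3185R_flat (G := G) R₁ R₂ 𝔏⟩

/-- ★ **ROW 24's LAYER-LEVEL R-TWIN FIRES**: `thm315FullPrinted_sectE_of_3185_onR` APPLIED at the flat Sect. E ∕ walk letters, for every `R₁ R₂ ops 𝔏`.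
[cite: Balaban1985BackgroundPropagators, Thm 3.15 (3.185)–(3.187) p.432, bookkeeping (non-vacuity)] -/
theorem thm315FullPrinted_sectE_of_3185_onR_fires_flat
    (ops : ∀ x : MemberY d ℓ hd hL b₀ b₁ Mstar, OperatorLayerY d ℓ hd hL b₀ b₁ Mstar 𝔸 G x)
    (𝔏 : ∀ x : MemberY d ℓ hd hL b₀ b₁ Mstar, CovLettersY 𝔸 x) :
    B9.Thm315FullPrinted c35Y geo9Y (bg9YR 𝔸 G R₁ R₂)
      (fun x => siteKernelR R₁ R₂ (operatorLayerYSectE 𝔸 G x (ops x) (𝔏 x) (sectELettersY_flat 𝔸 x) (rwLettersEY_flat 𝔸 G x)).Ck)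
      inΛY unitDistY
      (fun x => (operatorLayerYSectE 𝔸 G x (ops x) (𝔏 x) (sectELettersY_flat 𝔸 x) (rwLettersEY_flat 𝔸 G x)).GivenBy3185)
      (fun x => (operatorLayerYSectE 𝔸 G x (ops x) (𝔏 x) (sectELettersY_flat 𝔸 x) (rwLettersEY_flat 𝔸 G x)).HasRWExpC) :=
  thm315FullPrinted_sectE_of_3185_onR R₁ R₂ ops 𝔏 (fun x => sectELettersY_flat 𝔸 x) (fun x => rwLettersEY_flat 𝔸 G x)
    one_pos one_pos one_pos one_pos one_pos (hyps3185R_flat (G := G) R₁ R₂ 𝔏)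

end Thm315

/-! ## §3′ Record level (`G = SU(N)`): the edition-8 leaf `t315` over `bg9YR` fires at the flat Sect. E family -/

section Record

open scoped Matrix.Norms.L2Operator

variable (N : ℕ) (θ : Stage3Params) (Mstar' : ℕ)
  (R₁ R₂ : RegFamY θ.d₆ θ.ℓ₆ θ.hd' θ.hL' θ.b₀ θ.b₁ Mstar' (Matrix (Fin N) (Fin N) ℂ))

/-- ★ **ROW 24's RECORD-LEVEL R-TWIN FIRES**: `t315_opsYSectE_of_3185_onR N θ M⋆ R₁ R₂ ops 𝔏 𝔢 𝔴 …` APPLIED at `𝔢 := sectELettersY_flat`,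
`𝔴 := rwLettersEY_flat`, for every `R₁ R₂ ops 𝔏` — the binder block of the edition-8 leaf `t315` over `bg9YR` is inhabited.
[cite: Balaban1985BackgroundPropagators, Thm 3.15 (3.185)–(3.187) p.432, bookkeeping (non-vacuity)] -/
theorem t315_opsYSectE_of_3185_onR_fires_flat (ops : OpsY N θ Mstar') (𝔏 : LettersY N θ Mstar') :
    B9.Thm315FullPrinted c35Y geo9Y (bg9YR (Matrix (Fin N) (Fin N) ℂ) (specialUnitaryUnits (Fin N)) R₁ R₂)
      (fun x => siteKernelR R₁ R₂ (opsYSectE N θ Mstar' ops 𝔏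
        (fun x => sectELettersY_flat (Matrix (Fin N) (Fin N) ℂ) x)
        (fun x => rwLettersEY_flat (Matrix (Fin N) (Fin N) ℂ) (specialUnitaryUnits (Fin N)) x) x).Ck) inΛY unitDistY
      (fun x => (opsYSectE N θ Mstar' ops 𝔏 (fun x => sectELettersY_flat (Matrix (Fin N) (Fin N) ℂ) x)
        (fun x => rwLettersEY_flat (Matrix (Fin N) (Fin N) ℂ) (specialUnitaryUnits (Fin N)) x) x).GivenBy3185)
      (fun x => (opsYSectE N θ Mstar' ops 𝔏 (fun x => sectELettersY_flat (Matrix (Fin N) (Fin N) ℂ) x)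
        (fun x => rwLettersEY_flat (Matrix (Fin N) (Fin N) ℂ) (specialUnitaryUnits (Fin N)) x) x).HasRWExpC) :=
  t315_opsYSectE_of_3185_onR N θ Mstar' R₁ R₂ ops 𝔏 (fun x => sectELettersY_flat (Matrix (Fin N) (Fin N) ℂ) x)
    (fun x => rwLettersEY_flat (Matrix (Fin N) (Fin N) ℂ) (specialUnitaryUnits (Fin N)) x)
    one_pos one_pos one_pos one_pos one_pos (hyps3185R_flat (G := specialUnitaryUnits (Fin N)) R₁ R₂ 𝔏)

/-- ★ dag-n06-m's PRE-RULE ORIGINAL `B9Thm315WholeSectERepOn.t315_opsYSectE_of_3185_on` (over `bg9Y`) FIRES at the same data — its binder block at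
print's families `(regY335, regY336)` IS §3's (def-Y's `bg9Y = bg9YR regY335 regY336`, `rfl`; `B9Thm314Thm315LayerR.t315_opsYSectE_of_3185_onR_regY_iff`).
[cite: Balaban1985BackgroundPropagators, Thm 3.15 (3.185)–(3.187) p.432, bookkeeping (non-vacuity)] -/
theorem t315_opsYSectE_of_3185_on_fires_flat (ops : OpsY N θ Mstar') (𝔏 : LettersY N θ Mstar') :
    B9.Thm315FullPrinted c35Y geo9Y (bg9Y (Matrix (Fin N) (Fin N) ℂ) (specialUnitaryUnits (Fin N)))
      (fun x => (opsYSectE N θ Mstar' ops 𝔏 (fun x => sectELettersY_flat (Matrix (Fin N) (Fin N) ℂ) x)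
        (fun x => rwLettersEY_flat (Matrix (Fin N) (Fin N) ℂ) (specialUnitaryUnits (Fin N)) x) x).Ck) inΛY unitDistY
      (fun x => (opsYSectE N θ Mstar' ops 𝔏 (fun x => sectELettersY_flat (Matrix (Fin N) (Fin N) ℂ) x)
        (fun x => rwLettersEY_flat (Matrix (Fin N) (Fin N) ℂ) (specialUnitaryUnits (Fin N)) x) x).GivenBy3185)
      (fun x => (opsYSectE N θ Mstar' ops 𝔏 (fun x => sectELettersY_flat (Matrix (Fin N) (Fin N) ℂ) x)
        (fun x => rwLettersEY_flat (Matrix (Fin N) (Fin N) ℂ) (specialUnitaryUnits (Fin N)) x) x).HasRWExpC) :=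
  (t315_opsYSectE_of_3185_onR_regY_iff N θ Mstar' ops 𝔏 _ _).1
    (t315_opsYSectE_of_3185_onR_fires_flat N θ Mstar' _ _ ops 𝔏)

end Record

/-! ## §4 dag-n06-m's pre-rule original of rows 22–23 over `bg9Y` fires at the same data -/

section Original

variable [FiniteDimensional ℂ 𝔸]

/-- ★ dag-n06-m's PRE-RULE ORIGINAL `B9Thm314WholeCancellationLayer.thm314_pair_layerOfLetters` (rows 22–23 over `bg9Y`) FIRES at §2's witness data:
its binder block at print's families `(regY335, regY336)` IS §2's — every binder type over `bg9Y 𝔸 G x ≡ bg9YR 𝔸 G regY335 regY336 x` (`rfl`), so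
`thm314_pair_layerOfLettersR_binders_inhabited_flat (regY335 𝔸 G) (regY336 𝔸 G)` is literally its `∃`-witness; here the conclusion, through
`B9Thm314Thm315LayerR.thm314_pair_layerOfLettersR_regY_iff`. [cite: Balaban1985BackgroundPropagators, Thm 3.14 (3.154) pp.426–427, bookkeeping (non-vacuity)] -/
theorem thm314_pair_layerOfLetters_fires_flat (𝔈 : ∀ x : MemberY d ℓ hd hL b₀ b₁ Mstar, ExpLettersY 𝔸 G x) (c35 : ℝ) :
    Thm314Printed c35 geo9Y (bg9Y 𝔸 G) (fun x => (operatorLayerYOfLetters 𝔸 G x (covLettersY_flat 𝔸 x) (𝔈 x)).Kdiff) dOmegaY ∧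
      Thm314LocalPrinted c35 geo9Y (bg9Y 𝔸 G) (fun x => (operatorLayerYOfLetters 𝔸 G x (covLettersY_flat 𝔸 x) (𝔈 x)).Kdiff) OmKY dOmegaY :=
  (thm314_pair_layerOfLettersR_regY_iff (fun x => covLettersY_flat 𝔸 x) 𝔈 c35 OmKY dOmegaY).1
    (thm314_pair_layerOfLettersR_fires_flat (regY335 𝔸 G) (regY336 𝔸 G) 𝔈 c35)

end Original

end Literature.MathematicalPhysics.QuantumFieldTheory.Balaban1983to89.B9Thm314Thm315LayerRSat

end
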